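import Literature.MathematicalPhysics.QuantumLattice.HubbardSzSectorLadder
import Literature.MathematicalPhysics.QuantumLattice.HubbardSpinFlipSymmetry
import Literature.MathematicalPhysics.QuantumLattice.HubbardOddSectorReduction
import Literature.MathematicalPhysics.QuantumLattice.HubbardRingPerronFrobeniusProofs
import HarnessLib

/-!
# Sector energies of an `SU(2)`-invariant fermion Hamiltonian are monotone in `|S^z|`

Family `hubbard` (trunk T-QLATTICE); companion of `HubbardSzSectorLadder` (sector bookkeeping,
`upDownSector_groundState`), `HubbardSpinFlipSymmetry` (`E(N, -M) = E(N, M)`),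
`HubbardRingPerronFrobeniusProofs` / `HubbardOddSectorReduction` (`E₀(2n) = E(2n, 0)`,
`E₀(2n+1) = E(2n+1, ½)`). Written for the certified-numerics cell `pub-mbboot`, whose "spin-gap"
rows are certified intervals for `E(L², S^z = 1) - E₀(L²)` on the `4 × 4` torus: the results below
say that `E(N, S^z = 1)` IS the lowest energy over all sectors of nonzero `S^z` (even `N`), i.e.
the rows' quantity is the spin gap in the usual sense `min_{M ≠ 0} E(N, M) - E₀(N)`.

Write `E(N, M) := H.minEnergyOn (szSector N M)` for the lowest energy of `H` in the joint sector
`(N, S^z = M)`; for `(N↑, N↓) = (a, b)` this is the sector `(a + b, (a - b)/2)`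
(`mem_szSector_iff_isInSector`). For a Hermitian `H` on `Fock (Orb Λ)` that conserves `(N↑, N↓)`
(`PreservesSectors H`) and commutes with the spin-lowering operator `S⁻ = Σ_x c†_{x↓} c_{x↑}`:

* `upDownSector_groundState_of_preservesSectors` — ground states exist in every sector
  `(a, b)`, `a, b ≤ |Λ|`, and the sector energy bounds the form of `H` on the sector (the tree's
  `upDownSector_groundState` for a general `H`);
* `minEnergyOn_szSector_sub_one_le` — ONE `S⁻` STEP: if the sector `(N, M)` is realised as
  `(a, b)` with `b < a ≤ |Λ|` (so `M = (a - b)/2 ≥ ½`) then `E(N, M - 1) ≤ E(N, M)`: the sector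
  ground state `χ` of `(a, b)` is mapped by `S⁻` to a NONZERO (`S⁻` is injective on sectors with
  `N↑ > N↓`, `LiebThm1.eq_zero_of_spinMinus_mulVec_eq_zero`) eigenvector of `H` with the same
  eigenvalue in the sector `(a - 1, b + 1)`, whose Rayleigh quotient bounds `E(N, M - 1)`;
* `minEnergyOn_szSector_sub_le` — the chain: `E(N, M - k) ≤ E(N, M)` for `k ∈ ℕ` with
  `M - k ≥ -½` (`b + 2k ≤ a + 1`);
* `minEnergyOn_szSector_le_of_abs_le` — with, in addition, spin-exchange invariance
  (`relabel Orb.spinSwap H = H`, so that `E(N, -M) = E(N, M)`, `minEnergyOn_szSector_neg`):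
  **`E(N, M') ≤ E(N, M)` whenever `|M'| ≤ |M|`**, `M - M' ∈ ℤ`, for every realised sector
  `(N, M) = (a + b, (a - b)/2)`, `a, b ≤ |Λ|`.

For the Hubbard Hamiltonian `H = hamiltonian G t U` on any finite graph and all real `t`, `U`
(the three hypotheses are the tree's `LiebThm1.hamiltonian_isHermitian`,
`LiebThm1.preservesSectors_hamiltonian`, `LiebThm1.hamiltonian_commute_spinMinus`,
`relabel_spinSwap_hamiltonian`):

* `hubbard_minEnergyOn_szSector_le_of_abs_le` — `E(N, M') ≤ E(N, M)` for `|M'| ≤ |M|` as above;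
* `hubbard_groundEnergyAt_le_minEnergyOn_szSector` — `E₀(a + b) ≤ E(a + b, (a - b)/2)`;
* `hubbard_minEnergyOn_szSector_one_le` — `N = 2n`: for every integer `m ≠ 0` with
  `|m| ≤ n`, `n + |m| ≤ |Λ|`: `E(2n, 1) ≤ E(2n, m)` — **the lowest energy over all sectors of
  nonzero `S^z` is the `S^z = 1` sector energy** (`hubbard_isLeast_minEnergyOn_szSector_one`), so
  the spin gap `min_{M ≠ 0} E(2n, M) - E₀(2n)` is `E(2n, 1) - E₀(2n)` and
  `E₀(2n) = E(2n, 0) ≤ E(2n, 1)` (`hubbard_groundEnergyAt_le_minEnergyOn_szSector_one`);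
* `hubbard_minEnergyOn_szSector_half_le` — `N = 2n + 1`: `E₀(2n+1) = E(2n+1, ½) ≤ E(2n+1, m + ½)`
  for every integer `m` with the sector realised.

These are the elementary ("rotation invariance") half of the Lieb–Mattis ordering of energy
levels — in the words of Lieb–Mattis, `E(M) ≤ E(M + 1)` for `M ≥ 0` holds for any rotationally
invariant Hamiltonian; the STRICT ordering `E(S) < E(S + 1)` and the value of the ground-state spin
need model-specific input (Perron–Frobenius / reflection positivity: Lieb–Mattis 1962 Thm 2 for
Heisenberg models, `LiebMattisSectorPF`; Lieb 1989 Thm 2 for the half-filled Hubbard model,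
`HubbardHalfFilledGroundState`) and are NOT claimed here.

## References

* E. H. Lieb, D. Mattis, *Ordering energy levels of interacting spin systems*, J. Math. Phys. 3
  (1962) 749–751, §I (the trivial half `E(M) ≤ E(M+1)`, `M ≥ 0`, of the ordering). [LiebMattis1962Ordering]
* E. H. Lieb, *Two theorems on the Hubbard model*, Phys. Rev. Lett. 62 (1989) 1201, proof of
  Theorem 1 ("all competitors have a representative [at `S^z = 0`]" — `S^±` commute with `H` and
  are injective towards `S^z = 0`). [LiebPRL1989]
* H. Tasaki, *The Hubbard model — an introduction and selected rigorous results*, J. Phys.: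
  Condens. Matter 10 (1998) 4353, §2 (Definition 2.1, `E_min(S)`), read in arXiv:cond-mat/9512169
  p. 5; D. C. Mattis, *The Theory of Magnetism Made Simple* (2006) §5.10, eq. (5.177)
  (`E₀(S_T + 1) ≥ E₀(S_T)` via `S_T ≥ |M|`), read p. 231. [Tasaki1998] [Mattis2006]

All statements are finite-dimensional linear algebra. [folklore]
-/

noncomputable section

namespace Literature.MathematicalPhysics.QuantumLattice

open Matrix Finset HubbardWave0
open scoped ComplexOrder

section SU2

variable {Λ : Type*} [LinearOrder Λ] [Fintype Λ]

/-- **Ground states exist in every sector `(N↑, N↓) = (a, b)` with `a, b ≤ |Λ|`** for a Hermitian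
`H` conserving `(N↑, N↓)`, and the sector energy `E(a + b, (a - b)/2)` bounds `H` from below on the
sector: `E · ‖φ‖² ≤ Re ⟨φ, H φ⟩`. (The tree's `upDownSector_groundState` is the case
`H = hamiltonian G t U`.) Tasaki (1998) §2; Lieb, PRL 62 (1989) 1201, proof of Theorem 1.
[cite: LiebPRL1989, proof of Theorem 1] -/
theorem upDownSector_groundState_of_preservesSectors {H : Matrix (Finset (Orb Λ)) (Finset (Orb Λ)) ℂ}
    (hH : H.IsHermitian) (hHs : PreservesSectors H) {a b : ℕ} (ha : a ≤ Fintype.card Λ)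
    (hb : b ≤ Fintype.card Λ) :
    (∃ χ, IsInSector a b χ ∧ χ ≠ 0 ∧
        H *ᵥ χ = (((H.minEnergyOn (szSector (a + b) (((a : ℝ) - b) / 2))) : ℝ) : ℂ) • χ) ∧
      ∀ φ : Fock (Orb Λ), IsInSector a b φ →
        H.minEnergyOn (szSector (a + b) (((a : ℝ) - b) / 2)) * (star φ ⬝ᵥ φ).re ≤
          (expect H φ).re := by
  classical
  obtain ⟨α₀, -, hα₀⟩ : ∃ α₀ : Finset Λ, α₀ ⊆ univ ∧ α₀.card = a :=
    Finset.exists_subset_card_eq (by rwa [Finset.card_univ])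
  obtain ⟨β₀, -, hβ₀⟩ : ∃ β₀ : Finset Λ, β₀ ⊆ univ ∧ β₀.card = b :=
    Finset.exists_subset_card_eq (by rwa [Finset.card_univ])
  have hp : ∃ s : Finset (Orb Λ), (upPart s).card = a ∧ (downPart s).card = b :=
    ⟨pairSet α₀ β₀, by rw [upPart_pairSet, hα₀], by rw [downPart_pairSet, hβ₀]⟩
  have hinv : ∀ s s' : Finset (Orb Λ), ¬((upPart s).card = a ∧ (downPart s).card = b) →
      ((upPart s').card = a ∧ (downPart s').card = b) → H s s' = 0 := by
    intro s s' hs hs'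
    by_contra h
    have := hHs s s' h
    exact hs ⟨this.1.trans hs'.1, this.2.trans hs'.2⟩
  have hK : ∀ v : Fock (Orb Λ), v ∈ szSector (a + b) (((a : ℝ) - b) / 2) ↔
      ∀ s, ¬((upPart s).card = a ∧ (downPart s).card = b) → v s = 0 :=
    fun v => mem_szSector_iff_isInSector a b v
  obtain ⟨⟨v, hv, hv0, hHv⟩, hbd⟩ := Literature.MathematicalPhysics.QuantumLattice.sector_groundState H
    hH (fun s => (upPart s).card = a ∧ (downPart s).card = b) hp hinv
    (szSector (a + b) (((a : ℝ) - b) / 2)) hK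
  refine ⟨⟨v, (hK v).1 hv, hv0, hHv⟩, fun φ hφ => ?_⟩
  exact mul_norm_le_of_unit_bound_submodule H _ hbd ((hK φ).2 hφ)

/-- **One `S⁻` step.** For a Hermitian `H` conserving `(N↑, N↓)` and commuting with `S⁻`: if the
joint sector `(N, S^z = M)` is the coordinate sector `(a, b)` with `b < a ≤ |Λ|` (so `M ≥ ½`), then
`E(N, M - 1) ≤ E(N, M)` — the sector ground state of `(a, b)` is carried by `S⁻` to a nonzero
eigenvector of the same energy in `(a - 1, b + 1)`. Lieb–Mattis (1962) §I; Lieb, PRL 62 (1989)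
1201, proof of Theorem 1. [cite: LiebPRL1989, proof of Theorem 1] -/
theorem minEnergyOn_szSector_sub_one_le {H : Matrix (Finset (Orb Λ)) (Finset (Orb Λ)) ℂ}
    (hH : H.IsHermitian) (hHs : PreservesSectors H)
    (hcommM : Commute H Literature.MathematicalPhysics.QuantumLattice.spinMinus)
    {N : ℕ} {M : ℝ} (a b : ℕ) (hN : a + b = N) (hM : ((a : ℝ) - b) / 2 = M) (hba : b < a)
    (ha : a ≤ Fintype.card Λ) :
    H.minEnergyOn (szSector N (M - 1)) ≤ H.minEnergyOn (szSector N M) := by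
  obtain ⟨a', rfl⟩ : ∃ a', a = a' + 1 := ⟨a - 1, by omega⟩
  have hb : b ≤ Fintype.card Λ := by omega
  -- source sector `(a' + 1, b)`, target sector `(a', b + 1)`
  obtain ⟨⟨χ, hχ, hχ0, hHχ⟩, -⟩ := upDownSector_groundState_of_preservesSectors hH hHs ha hb
  obtain ⟨-, hbd⟩ := upDownSector_groundState_of_preservesSectors hH hHs (a := a') (b := b + 1)
    (by omega) (by omega)
  have e1 : a' + (b + 1) = N := by omega
  have e2 : ((a' : ℝ) - (b + 1 : ℕ)) / 2 = M - 1 := by rw [← hM]; push_cast; ring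
  have e3 : (((a' + 1 : ℕ) : ℝ) - b) / 2 = M := by rw [← hM]
  rw [hN, e3] at hHχ
  rw [e1, e2] at hbd
  set φ := Literature.MathematicalPhysics.QuantumLattice.spinMinus *ᵥ χ with hφ
  have hφs : IsInSector a' (b + 1) φ := LiebThm1.lowersSpin_spinMinus.isInSector_mulVec hχ
  have hφ0 : φ ≠ 0 := fun h0 => hχ0 (LiebThm1.eq_zero_of_spinMinus_mulVec_eq_zero hba hχ h0)
  have hHφ : H *ᵥ φ = ((H.minEnergyOn (szSector N M) : ℝ) : ℂ) • φ := by
    rw [hφ, mulVec_mulVec, hcommM.eq, ← mulVec_mulVec, hHχ, mulVec_smul]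
  have h1 := hbd φ hφs
  rw [expect, hHφ, dotProduct_smul, smul_eq_mul, Complex.re_ofReal_mul] at h1
  have hpos : 0 < (star φ ⬝ᵥ φ).re := (Complex.pos_iff.1 (dotProduct_star_self_pos_iff.2 hφ0)).1
  exact le_of_mul_le_mul_right h1 hpos

/-- **One `S⁺` step** (mirror image): if `(N, S^z = M)` is the coordinate sector `(a, b)` with
`a < b ≤ |Λ|` (so `M ≤ -½`) and `H` commutes with `S⁺`, then `E(N, M + 1) ≤ E(N, M)`.
Lieb–Mattis (1962) §I; Lieb, PRL 62 (1989) 1201, proof of Theorem 1.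
[cite: LiebPRL1989, proof of Theorem 1] -/
theorem minEnergyOn_szSector_add_one_le {H : Matrix (Finset (Orb Λ)) (Finset (Orb Λ)) ℂ}
    (hH : H.IsHermitian) (hHs : PreservesSectors H) (hcommP : Commute H spinPlus)
    {N : ℕ} {M : ℝ} (a b : ℕ) (hN : a + b = N) (hM : ((a : ℝ) - b) / 2 = M) (hab : a < b)
    (hb : b ≤ Fintype.card Λ) :
    H.minEnergyOn (szSector N (M + 1)) ≤ H.minEnergyOn (szSector N M) := by
  obtain ⟨b', rfl⟩ : ∃ b', b = b' + 1 := ⟨b - 1, by omega⟩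
  have ha : a ≤ Fintype.card Λ := by omega
  -- source sector `(a, b' + 1)`, target sector `(a + 1, b')`
  obtain ⟨⟨χ, hχ, hχ0, hHχ⟩, -⟩ := upDownSector_groundState_of_preservesSectors hH hHs ha hb
  obtain ⟨-, hbd⟩ := upDownSector_groundState_of_preservesSectors hH hHs (a := a + 1) (b := b')
    (by omega) (by omega)
  have e1 : a + 1 + b' = N := by omega
  have e2 : (((a + 1 : ℕ) : ℝ) - b') / 2 = M + 1 := by rw [← hM]; push_cast; ring
  have e3 : ((a : ℝ) - (b' + 1 : ℕ)) / 2 = M := by rw [← hM]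
  rw [hN, e3] at hHχ
  rw [e1, e2] at hbd
  set φ := spinPlus *ᵥ χ with hφ
  have hφs : IsInSector (a + 1) b' φ := LiebThm1.raisesSpin_spinPlus.isInSector_mulVec hχ
  have hφ0 : φ ≠ 0 := fun h0 => hχ0 (LiebThm1.eq_zero_of_spinPlus_mulVec_eq_zero hab hχ h0)
  have hHφ : H *ᵥ φ = ((H.minEnergyOn (szSector N M) : ℝ) : ℂ) • φ := by
    rw [hφ, mulVec_mulVec, hcommP.eq, ← mulVec_mulVec, hHχ, mulVec_smul]
  have h1 := hbd φ hφs
  rw [expect, hHφ, dotProduct_smul, smul_eq_mul, Complex.re_ofReal_mul] at h1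
  have hpos : 0 < (star φ ⬝ᵥ φ).re := (Complex.pos_iff.1 (dotProduct_star_self_pos_iff.2 hφ0)).1
  exact le_of_mul_le_mul_right h1 hpos

/-- **The `S⁻` chain**: `E(N, M - k) ≤ E(N, M)` for every `k ∈ ℕ` with `M - k ≥ -½`, i.e. for the
coordinate sector `(a, b)` of `(N, M)`: `b + 2k ≤ a + 1`, `a ≤ |Λ|`. Lieb–Mattis (1962) §I; Lieb,
PRL 62 (1989) 1201, proof of Theorem 1. [cite: LiebPRL1989, proof of Theorem 1] -/
theorem minEnergyOn_szSector_sub_le {H : Matrix (Finset (Orb Λ)) (Finset (Orb Λ)) ℂ}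
    (hH : H.IsHermitian) (hHs : PreservesSectors H)
    (hcommM : Commute H Literature.MathematicalPhysics.QuantumLattice.spinMinus)
    {N : ℕ} {M : ℝ} (a b : ℕ) (hN : a + b = N) (hM : ((a : ℝ) - b) / 2 = M)
    (ha : a ≤ Fintype.card Λ) (k : ℕ) (hk : b + 2 * k ≤ a + 1) :
    H.minEnergyOn (szSector N (M - k)) ≤ H.minEnergyOn (szSector N M) := by
  induction k with
  | zero => simp
  | succ k ih =>
    have hk' : b + 2 * k ≤ a + 1 := by omega
    -- the sector `(N, M - k)` is `(a - k, b + k)` with `b + k < a - k`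
    have hstep := minEnergyOn_szSector_sub_one_le hH hHs hcommM (N := N) (M := M - k)
      (a - k) (b + k) (by omega) (by rw [← hM, Nat.cast_sub (by omega)]; push_cast; ring)
      (by omega) (by omega)
    have e : (M - k - 1 : ℝ) = M - (k + 1 : ℕ) := by push_cast; ring
    rw [e] at hstep
    exact hstep.trans (ih hk')

/-- **The `S⁺` chain**: `E(N, M + k) ≤ E(N, M)` for every `k ∈ ℕ` with `M + k ≤ ½`, i.e. for the
coordinate sector `(a, b)` of `(N, M)`: `a + 2k ≤ b + 1`, `b ≤ |Λ|`. Lieb–Mattis (1962) §I; Lieb,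
PRL 62 (1989) 1201, proof of Theorem 1. [cite: LiebPRL1989, proof of Theorem 1] -/
theorem minEnergyOn_szSector_add_le {H : Matrix (Finset (Orb Λ)) (Finset (Orb Λ)) ℂ}
    (hH : H.IsHermitian) (hHs : PreservesSectors H) (hcommP : Commute H spinPlus)
    {N : ℕ} {M : ℝ} (a b : ℕ) (hN : a + b = N) (hM : ((a : ℝ) - b) / 2 = M)
    (hb : b ≤ Fintype.card Λ) (k : ℕ) (hk : a + 2 * k ≤ b + 1) :
    H.minEnergyOn (szSector N (M + k)) ≤ H.minEnergyOn (szSector N M) := by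
  induction k with
  | zero => simp
  | succ k ih =>
    have hk' : a + 2 * k ≤ b + 1 := by omega
    have hstep := minEnergyOn_szSector_add_one_le hH hHs hcommP (N := N) (M := M + k)
      (a + k) (b - k) (by omega) (by rw [← hM, Nat.cast_sub (by omega)]; push_cast; ring)
      (by omega) (by omega)
    have e : (M + k + 1 : ℝ) = M + (k + 1 : ℕ) := by push_cast; ring
    rw [e] at hstep
    exact hstep.trans (ih hk')

/-- **Sector energies are nondecreasing in `|S^z|`.** For a Hermitian `H` on `Fock (Orb Λ)` that
conserves `(N↑, N↓)`, commutes with `S⁻` and is spin-exchange invariant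
(`relabel Orb.spinSwap H = H`): if the joint sector `(N, S^z = M)` is realised as a coordinate sector
`(a, b)` (`a + b = N`, `M = (a - b)/2`, `a, b ≤ |Λ|`), then `E(N, M') ≤ E(N, M)` for every `M'`
with `|M'| ≤ |M|` and `M - M' ∈ ℤ`. (Spin exchange reduces to `M ≥ 0` and `M' ≥ -½`; then the
`S⁻` chain.) Lieb–Mattis, J. Math. Phys. 3 (1962) 749, §I; Lieb, PRL 62 (1989) 1201, proof of
Theorem 1; Mattis (2006) §5.10. [cite: LiebPRL1989, proof of Theorem 1] -/
theorem minEnergyOn_szSector_le_of_abs_le {H : Matrix (Finset (Orb Λ)) (Finset (Orb Λ)) ℂ}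
    (hH : H.IsHermitian) (hHs : PreservesSectors H)
    (hcommM : Commute H Literature.MathematicalPhysics.QuantumLattice.spinMinus)
    (hswap : relabel (Orb.spinSwap : Orb Λ ≃ Orb Λ) H = H)
    {N : ℕ} {M M' : ℝ} (a b : ℕ) (hN : a + b = N) (hM : ((a : ℝ) - b) / 2 = M)
    (ha : a ≤ Fintype.card Λ) (hb : b ≤ Fintype.card Λ) (hMM' : ∃ z : ℤ, M - M' = z)
    (habs : |M'| ≤ |M|) :
    H.minEnergyOn (szSector N M') ≤ H.minEnergyOn (szSector N M) := by
  obtain ⟨z, hz⟩ := hMM'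
  -- Step 1: reduce to `M ≥ 0` (spin exchange swaps `(a, b)` and `(b, a)`).
  suffices key : ∀ (P P' : ℝ) (c d : ℕ), c + d = N → ((c : ℝ) - d) / 2 = P → c ≤ Fintype.card Λ →
      d ≤ c → (∃ w : ℤ, P - P' = w) → |P'| ≤ P →
      H.minEnergyOn (szSector N P') ≤ H.minEnergyOn (szSector N P) by
    rcases le_total b a with hba | hab
    · have hba' : (b : ℝ) ≤ a := by exact_mod_cast hba
      have hM0 : 0 ≤ M := by rw [← hM]; linarith
      exact key M M' a b hN hM ha hba ⟨z, hz⟩ (by rwa [abs_of_nonneg hM0] at habs)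
    · have hab' : (a : ℝ) ≤ b := by exact_mod_cast hab
      have hM0 : M ≤ 0 := by rw [← hM]; linarith
      have h := key (-M) (-M') b a (by omega) (by rw [← hM]; ring) hb hab
        ⟨-z, by rw [Int.cast_neg, ← hz]; ring⟩ (by rwa [abs_neg, ← abs_of_nonpos hM0])
      rwa [minEnergyOn_szSector_neg hswap, minEnergyOn_szSector_neg hswap] at h
  intro P P' c d hcd hP hc hdc hw hP'
  obtain ⟨w, hw⟩ := hw
  -- `2P = c - d` is an integer, hence so is `2P'`; write `P' = P - w`.
  have hP'eq : P' = P - w := by linarith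
  -- Step 2: reduce to `P' ≥ -1/2` (otherwise replace `P'` by `-P'`, again of the form `P - integer`).
  suffices key2 : ∀ k : ℕ, -(1 : ℝ) / 2 ≤ P - k → |P - k| ≤ P →
      H.minEnergyOn (szSector N (P - k)) ≤ H.minEnergyOn (szSector N P) by
    have hw0 : 0 ≤ w := by
      have : (w : ℝ) ≥ 0 := by have := le_abs_self P'; linarith
      exact_mod_cast this
    by_cases hhalf : -(1 : ℝ) / 2 ≤ P'
    · obtain ⟨k, hk⟩ : ∃ k : ℕ, (w : ℝ) = k := ⟨w.toNat, by exact_mod_cast (Int.toNat_of_nonneg hw0).symm⟩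
      rw [hP'eq, hk] at hP' ⊢
      exact key2 k (by rw [← hk, ← hP'eq]; exact hhalf) hP'
    · -- `-P' = P - w'` with `w' = (c - d) - w`
      push Not at hhalf
      have hnegeq : -P' = P - (((c : ℤ) - d - w : ℤ) : ℝ) := by
        rw [hP'eq, ← hP]; push_cast; ring
      have hw'0 : (0 : ℤ) ≤ (c : ℤ) - d - w := by
        have h1 : (((c : ℤ) - d - w : ℤ) : ℝ) = P + P' := by rw [hP'eq, ← hP]; push_cast; ring
        have h2 : (0 : ℝ) ≤ P + P' := by have := neg_abs_le P'; linarith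
        exact_mod_cast h1 ▸ h2
      obtain ⟨k, hk⟩ : ∃ k : ℕ, (((c : ℤ) - d - w : ℤ) : ℝ) = k :=
        ⟨((c : ℤ) - d - w).toNat, by exact_mod_cast (Int.toNat_of_nonneg hw'0).symm⟩
      have h := key2 k (by rw [← hk, ← hnegeq]; linarith) (by rw [← hk, ← hnegeq, abs_neg]; exact hP')
      rwa [← hk, ← hnegeq, minEnergyOn_szSector_neg hswap] at h
  intro k hk _
  refine minEnergyOn_szSector_sub_le hH hHs hcommM c d hcd hP hc k ?_
  -- `b + 2k ≤ a + 1` from `P - k ≥ -1/2`, `2P = c - d`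
  have h1 : (2 : ℝ) * k ≤ (c : ℝ) - d + 1 := by rw [← hP] at hk; linarith
  have h2 : ((2 * k : ℕ) : ℝ) ≤ ((c + 1 : ℕ) : ℝ) - d := by push_cast; linarith
  have h3 : ((d + 2 * k : ℕ) : ℝ) ≤ ((c + 1 : ℕ) : ℝ) := by push_cast at h2 ⊢; linarith
  exact_mod_cast h3

end SU2

/-! ### The Hubbard Hamiltonian -/

section Hubbard

variable {Λ : Type*} [LinearOrder Λ] [Fintype Λ] (G : SimpleGraph Λ) [DecidableRel G.Adj]

/-- **Hubbard sector energies are nondecreasing in `|S^z|`** (any finite graph, any real `t`, `U`):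
if `(N, S^z = M)` is the coordinate sector `(a, b)` (`a + b = N`, `M = (a - b)/2`, `a, b ≤ |Λ|`) then
`E(N, M') ≤ E(N, M)` for all `M'` with `|M'| ≤ |M|`, `M - M' ∈ ℤ`. Lieb–Mattis, J. Math. Phys. 3
(1962) 749, §I; Lieb, PRL 62 (1989) 1201, proof of Theorem 1. [cite: LiebPRL1989, proof of Theorem 1] -/
theorem hubbard_minEnergyOn_szSector_le_of_abs_le (t U : ℝ) {N : ℕ} {M M' : ℝ} (a b : ℕ)
    (hN : a + b = N) (hM : ((a : ℝ) - b) / 2 = M) (ha : a ≤ Fintype.card Λ) (hb : b ≤ Fintype.card Λ)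
    (hMM' : ∃ z : ℤ, M - M' = z) (habs : |M'| ≤ |M|) :
    (hamiltonian G t U).minEnergyOn (szSector N M') ≤ (hamiltonian G t U).minEnergyOn (szSector N M) :=
  minEnergyOn_szSector_le_of_abs_le (LiebThm1.hamiltonian_isHermitian G t U)
    (LiebThm1.preservesSectors_hamiltonian G t U) (LiebThm1.hamiltonian_commute_spinMinus G t U)
    (relabel_spinSwap_hamiltonian G t U) a b hN hM ha hb hMM' habs

/-- **The ground-state energy is below every sector energy**: `E₀(a + b) ≤ E(a + b, (a - b)/2)` for
`a, b ≤ |Λ|` (the sector Rayleigh set is part of the `N`-particle one; the sector is nonempty).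
Tasaki (1998) §2 (Definition 2.1: `E_min(S) ≥` the ground-state energy); Lieb, PRL 62 (1989) 1201,
proof of Theorem 1. [cite: LiebPRL1989, proof of Theorem 1] -/
theorem hubbard_groundEnergyAt_le_minEnergyOn_szSector (t U : ℝ) {N : ℕ} {M : ℝ} (a b : ℕ)
    (hN : a + b = N) (hM : ((a : ℝ) - b) / 2 = M) (ha : a ≤ Fintype.card Λ) (hb : b ≤ Fintype.card Λ) :
    groundEnergyAt G t U N ≤ (hamiltonian G t U).minEnergyOn (szSector N M) := by
  classical
  set H := hamiltonian G t U with hH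
  obtain ⟨⟨χ, hχ, hχ0, -⟩, -⟩ := upDownSector_groundState G t U ha hb
  have hχK : χ ∈ szSector N M := by
    rw [← hN, ← hM]; exact (mem_szSector_iff_isInSector a b χ).2 hχ
  rw [groundEnergyAt, groundEnergy, Matrix.minEnergyOn]
  refine csInf_le_csInf (LiebThm1.bddBelow_energySet H N) ?_ ?_
  · obtain ⟨c, -, hc1⟩ := Literature.MathematicalPhysics.QuantumLattice.exists_smul_unit hχ0
    exact ⟨_, c • χ, Submodule.smul_mem _ c hχK, hc1, rfl⟩
  · rintro E ⟨φ, hφ, hφ1, rfl⟩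
    exact ⟨φ, ((mem_szSector_iff _ _ _).1 hφ).1, hφ1, rfl⟩

/-- **Even `N = 2n`: the `S^z = 1` sector energy is the lowest over all sectors of nonzero `S^z`.**
For every integer `m ≠ 0` with `|m| ≤ n` and `n + |m| ≤ |Λ|` (the sector `(2n, m)` is realised as
`(n + m, n - m)`): `E(2n, 1) ≤ E(2n, m)`. Hence the spin gap `min_{M ≠ 0} E(2n, M) - E₀(2n)` of the
`2n`-electron Hubbard model is `E(2n, 1) - E₀(2n)`. Lieb–Mattis (1962) §I; Lieb, PRL 62 (1989)
1201, proof of Theorem 1. [cite: LiebPRL1989, proof of Theorem 1] -/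
theorem hubbard_minEnergyOn_szSector_one_le (t U : ℝ) {n : ℕ} {m : ℤ} (hm : m ≠ 0)
    (hmn : m.natAbs ≤ n) (hΛ : n + m.natAbs ≤ Fintype.card Λ) :
    (hamiltonian G t U).minEnergyOn (szSector (2 * n) 1) ≤
      (hamiltonian G t U).minEnergyOn (szSector (2 * n) (m : ℝ)) := by
  -- the sector `(2n, m)` is `(n + |m|, n - |m|)` or its mirror; use `(a, b) = (n + m, n - m)` via `ℤ`
  have hreal : ∃ a b : ℕ, a + b = 2 * n ∧ ((a : ℝ) - b) / 2 = (m : ℝ) ∧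
      a ≤ Fintype.card Λ ∧ b ≤ Fintype.card Λ := by
    rcases le_or_gt 0 m with hm0 | hm0
    · refine ⟨n + m.natAbs, n - m.natAbs, by omega, ?_, hΛ, by omega⟩
      have h' : ((m.natAbs : ℕ) : ℝ) = (m : ℝ) := by rw [Nat.cast_natAbs, abs_of_nonneg hm0]
      rw [Nat.cast_sub hmn]; push_cast; rw [h']; ring
    · refine ⟨n - m.natAbs, n + m.natAbs, by omega, ?_, by omega, hΛ⟩
      have h' : ((m.natAbs : ℕ) : ℝ) = -(m : ℝ) := by
        rw [Nat.cast_natAbs, abs_of_neg hm0, Int.cast_neg]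
      rw [Nat.cast_sub hmn]; push_cast; rw [h']; ring
  obtain ⟨a, b, hN, hM, ha, hb⟩ := hreal
  refine hubbard_minEnergyOn_szSector_le_of_abs_le G t U a b hN hM ha hb ⟨m - 1, by push_cast; ring⟩ ?_
  rw [abs_one]
  have : (1 : ℤ) ≤ |m| := Int.one_le_abs hm
  exact_mod_cast this

/-- **Even `N = 2n`: `E₀(2n) ≤ E(2n, 1)`** (`n + 1 ≤ |Λ|`, `1 ≤ n`): with
`groundEnergyAt_eq_minEnergyOn_szSector` (`E₀(2n) = E(2n, 0)`) and
`hubbard_minEnergyOn_szSector_one_le` the sector energies of the `2n`-electron Hubbard model satisfy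
`E₀(2n) = E(2n, 0) ≤ E(2n, ±1) ≤ E(2n, ±2) ≤ …`. Lieb, PRL 62 (1989) 1201, proof of Theorem 1.
[cite: LiebPRL1989, proof of Theorem 1] -/
theorem hubbard_groundEnergyAt_le_minEnergyOn_szSector_one (t U : ℝ) {n : ℕ} (hn : 1 ≤ n)
    (hΛ : n + 1 ≤ Fintype.card Λ) :
    groundEnergyAt G t U (2 * n) ≤ (hamiltonian G t U).minEnergyOn (szSector (2 * n) 1) :=
  hubbard_groundEnergyAt_le_minEnergyOn_szSector G t U (n + 1) (n - 1) (by omega)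
    (by rw [Nat.cast_sub hn]; push_cast; ring) hΛ (by omega)

/-- **Even `N = 2n`: `E(2n, 1)` is the least element of `{E(2n, m) : m ∈ ℤ, m ≠ 0, |m| ≤ n,
n + |m| ≤ |Λ|}`** (the set of energies of all realised sectors of nonzero `S^z`; `1 ≤ n`,
`n + 1 ≤ |Λ|`). Lieb–Mattis (1962) §I; Lieb, PRL 62 (1989) 1201, proof of Theorem 1.
[cite: LiebPRL1989, proof of Theorem 1] -/
theorem hubbard_isLeast_minEnergyOn_szSector_one (t U : ℝ) {n : ℕ} (hn : 1 ≤ n)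
    (hΛ : n + 1 ≤ Fintype.card Λ) :
    IsLeast {E : ℝ | ∃ m : ℤ, m ≠ 0 ∧ m.natAbs ≤ n ∧ n + m.natAbs ≤ Fintype.card Λ ∧
        E = (hamiltonian G t U).minEnergyOn (szSector (2 * n) (m : ℝ))}
      ((hamiltonian G t U).minEnergyOn (szSector (2 * n) 1)) := by
  refine ⟨⟨1, one_ne_zero, by simpa using hn, by simpa using hΛ, by simp⟩, ?_⟩
  rintro E ⟨m, hm, hmn, hmΛ, rfl⟩
  exact hubbard_minEnergyOn_szSector_one_le G t U hm hmn hmΛ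

/-- **Odd `N = 2n + 1`: `E₀(2n+1) = E(2n+1, ½) ≤ E(2n+1, m + ½)`** for every integer `m` with the
sector `(2n+1, m + ½) = (n + 1 + m, n - m)` realised (`-(n+1) ≤ m ≤ n`, both coordinates `≤ |Λ|`).
Lieb, PRL 62 (1989) 1201, proof of Theorem 1; Tasaki (1998) §2. [cite: LiebPRL1989, proof of Theorem 1] -/
theorem hubbard_minEnergyOn_szSector_half_le (t U : ℝ) {n : ℕ} {m : ℤ} (a b : ℕ)
    (hN : a + b = 2 * n + 1) (hM : ((a : ℝ) - b) / 2 = (m : ℝ) + 1 / 2)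
    (ha : a ≤ Fintype.card Λ) (hb : b ≤ Fintype.card Λ) :
    (hamiltonian G t U).minEnergyOn (szSector (2 * n + 1) (1 / 2)) ≤
      (hamiltonian G t U).minEnergyOn (szSector (2 * n + 1) ((m : ℝ) + 1 / 2)) := by
  refine hubbard_minEnergyOn_szSector_le_of_abs_le G t U a b hN hM ha hb ⟨m, by ring⟩ ?_
  rw [abs_of_pos (by norm_num : (0 : ℝ) < 1 / 2)]
  rcases le_or_gt 0 m with hm0 | hm0
  · have : (0 : ℝ) ≤ m := by exact_mod_cast hm0
    rw [abs_of_nonneg (by linarith)]; linarith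
  · have hm1 : m ≤ -1 := by omega
    have : (m : ℝ) ≤ -1 := by exact_mod_cast hm1
    rw [abs_of_nonpos (by linarith)]; linarith

/-- **Odd `N = 2n + 1`: the ground-state energy is below every half-odd sector energy and equals
the `S^z = ½` one**: `E₀(2n+1) ≤ E(2n+1, m + ½)` (sector realised), with
`E₀(2n+1) = E(2n+1, ½)` the tree's `groundEnergyAt_eq_minEnergyOn_szSector_odd`.
Lieb, PRL 62 (1989) 1201, proof of Theorem 1. [cite: LiebPRL1989, proof of Theorem 1] -/
theorem hubbard_groundEnergyAt_le_minEnergyOn_szSector_half (t U : ℝ) {n : ℕ} {m : ℤ} (a b : ℕ)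
    (hN : a + b = 2 * n + 1) (hM : ((a : ℝ) - b) / 2 = (m : ℝ) + 1 / 2)
    (ha : a ≤ Fintype.card Λ) (hb : b ≤ Fintype.card Λ) :
    groundEnergyAt G t U (2 * n + 1) ≤
      (hamiltonian G t U).minEnergyOn (szSector (2 * n + 1) ((m : ℝ) + 1 / 2)) :=
  hubbard_groundEnergyAt_le_minEnergyOn_szSector G t U a b hN hM ha hb

end Hubbard

end Literature.MathematicalPhysics.QuantumLattice
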